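import Literature.Analysis.FunctionSpaces.HolderInterpolation
import Literature.Analysis.FunctionSpaces.HolderNormProofs
import Literature.Analysis.FunctionSpaces.TorusHolderBridge
import HarnessLib

/-!
# Algebra of the `C^{k,r}` norms `‖f‖_{C^{k,r}} = ∑_{j ≤ k} ‖Dʲf‖_∞ + [Dᵏf]_r`

Analysis/FunctionSpaces support file. The accepted extended norms `eContDiffHolderNorm k r f` of
`f : E' → Y` on a real normed space and `Torus.eContDiffHolderNorm k r g` of `g : T^d → Y` (the
norm of the periodic lift, `HolderNorm.lean`; Gilbarg–Trudinger §4.1 (4.4), De Lellis–Székelyhidi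
2013 §2 for the torus) are total `ℝ≥0∞`-valued functionals. This file provides the elementary
algebra that estimates in these norms use at every step (Buckmaster–De Lellis–Székelyhidi–Vicol
2019, App. A: "`‖f‖_{m+α} = ‖f‖_m + [f]_{m+α}`" with the triangle inequality, homogeneity and the
monotonicity `‖f‖_{s} ≲ ‖f‖_{r}`, `s ≤ r`, used tacitly throughout §§3–6):

* extraction of pointwise bounds: `enorm_iteratedFDeriv_le_eContDiffHolderNorm`,
  `enorm_le_eContDiffHolderNorm`, `eHolderNorm_iteratedFDeriv_le_eContDiffHolderNorm`;
* triangle inequality, negation, subtraction, real homogeneity, finite sums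
  (`eContDiffHolderNorm_add_le`, `_neg`, `_sub_le`, `_const_smul`, `_sum_le`) for `C^k` maps;
* comparison of exponents and orders: `eContDiffHolderNorm_exponent_zero_le`
  (`‖f‖_{C^{k,0}} ≤ 3‖f‖_{C^{k,r}}`: Mathlib's `0`-Hölder seminorm is the oscillation) and
  `eContDiffHolderNorm_le_three_mul_succ` (`‖f‖_{C^{k,r}} ≤ 3‖f‖_{C^{k+1,r'}}` for `r ≤ 1`, by the
  interpolation `[Dᵏf]_r ≤ ‖Dᵏ⁺¹f‖_∞ + 2‖Dᵏf‖_∞` at unit scale,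
  `holderWith_of_lipschitzWith_of_edist_le`);
* the torus versions of all of the above (the lift is linear), and — from the discharged fact
  `Torus.IsSmooth.memContDiffHolder_holds` (`HolderNormProofs.lean`: smooth functions on the
  torus are `C^{k,r}` for all `k` and `r ≤ 1`) — the finiteness
  `Torus.IsSmooth.eContDiffHolderNorm_lt_top` and the realisation of the `C^{k,r}` norm as a Hölder
  constant of `Dᵏ(lift f)` (`Torus.IsSmooth.holderWith_iteratedFDeriv`).

## Mathlib / tree search

Mathlib (this pin): `iteratedFDeriv_add`, `iteratedFDeriv_neg`, `iteratedFDeriv_const_smul_apply`,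
`iteratedFDeriv_comp_add_right`, `eHolderNorm_add_le`, `eHolderNorm_smul`,
`lipschitzWith_of_nnnorm_fderiv_le`, `norm_fderiv_iteratedFDeriv`; no `C^{k,α}` norm. Tree:
`HolderNorm` (definitions, `eSupNorm_add_le`, `eSupNorm_neg`), `HolderNormProofs`
(`Torus.IsSmooth.memContDiffHolder_holds`), `HolderInterpolation`
(`holderWith_of_lipschitzWith_of_edist_le`, `eContDiffHolderNorm_le_of_norm_iteratedFDeriv_le`),
`TorusHolderBridge` (`eBoundedHolderNorm_const_smul`, partial derivatives); scattered special cases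
in `FluidPDE/ElgindiBlowup` (`eSupNorm_iteratedFDeriv_le_eContDiffHolderNorm`),
`FluidPDE/EulerTimeScaling` (`eContDiffHolderNorm_one_const_smul`, `eSupNorm_const_smul`),
`FluidPDE/CheskidovGluedCalculus` — not importable here (wrong direction) and restricted to
`k = 1` or to sup norms; the general statements below subsume them.

## References

* D. Gilbarg, N. Trudinger, *Elliptic PDE of second order* (2001), §4.1, (4.4)–(4.7).
* T. Buckmaster, C. De Lellis, L. Székelyhidi Jr., V. Vicol, *Onsager's conjecture for admissible
  weak solutions*, CPAM 72 (2019), App. A (Hölder norms, (A.1)–(A.3)).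
* C. De Lellis, L. Székelyhidi Jr., *Dissipative continuous Euler flows*, Invent. Math. 193
  (2013), §2.
-/

open Set Filter
open scoped NNReal ENNReal ContDiff

noncomputable section

namespace Literature.Analysis.FunctionSpaces

/-! ## Sup norms and Hölder seminorms: two more elementary facts -/

section Elementary

variable {X Y : Type*} [NormedAddCommGroup Y]

/-- Homogeneity of the sup norm: `‖c • g‖_∞ = |c| ‖g‖_∞`. [folklore] -/
theorem eSupNorm_const_smul_eq [NormedSpace ℝ Y] (c : ℝ) (g : X → Y) :
    eSupNorm (c • g) = ‖c‖ₑ * eSupNorm g := by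
  simp only [eSupNorm, Pi.smul_apply, enorm_smul, ENNReal.mul_iSup]

/-- The `0`-Hölder seminorm (Mathlib: the oscillation) is at most twice the sup norm. [folklore] -/
theorem eHolderNorm_zero_le_two_mul_eSupNorm [PseudoEMetricSpace X] (g : X → Y) :
    eHolderNorm 0 g ≤ 2 * eSupNorm g := by
  by_cases h : eSupNorm g = ⊤
  · rw [h, ENNReal.mul_top (by norm_num)]
    exact le_top
  have h2 : 2 * eSupNorm g ≠ ⊤ := ENNReal.mul_ne_top (by norm_num) h
  have hH : HolderWith (2 * eSupNorm g).toNNReal 0 g := by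
    intro x y
    rw [ENNReal.coe_toNNReal h2, NNReal.coe_zero, ENNReal.rpow_zero, mul_one, edist_eq_enorm_sub]
    calc ‖g x - g y‖ₑ ≤ ‖g x‖ₑ + ‖g y‖ₑ := enorm_sub_le
      _ ≤ eSupNorm g + eSupNorm g := add_le_add (enorm_le_eSupNorm g x) (enorm_le_eSupNorm g y)
      _ = 2 * eSupNorm g := (two_mul _).symm
  exact hH.eHolderNorm_le.trans (le_of_eq (ENNReal.coe_toNNReal h2))

/-- A Hölder map scaled by a real constant is Hölder with the scaled constant (deliberately a
dot-notation extension in Mathlib's `HolderWith` namespace, next to `HolderWith.add`). [folklore] -/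
theorem _root_.HolderWith.const_smul_real [PseudoEMetricSpace X] [NormedSpace ℝ Y] {C r : ℝ≥0}
    {f : X → Y} (hf : HolderWith C r f) (c : ℝ) : HolderWith (‖c‖₊ * C) r (c • f) := by
  intro x y
  rw [Pi.smul_apply, Pi.smul_apply, edist_smul₀, ENNReal.smul_def, smul_eq_mul, ENNReal.coe_mul,
    mul_assoc]
  gcongr
  exact hf x y

/-- One-sided homogeneity of the Hölder seminorm under real scalars. [folklore] -/
theorem eHolderNorm_const_smul_le [PseudoEMetricSpace X] [NormedSpace ℝ Y] (r : ℝ≥0) (c : ℝ)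
    (f : X → Y) : eHolderNorm r (c • f) ≤ ‖c‖ₑ * eHolderNorm r f := by
  rcases eq_or_ne c 0 with rfl | hc
  · rw [zero_smul, eHolderNorm_zero]
    exact bot_le
  rw [eHolderNorm, eHolderNorm, ENNReal.mul_iInf_of_ne (by simpa using hc) enorm_ne_top]
  refine le_iInf fun C => ?_
  rw [ENNReal.mul_iInf_of_ne (by simpa using hc) enorm_ne_top]
  refine le_iInf fun hC => ?_
  refine (iInf₂_le (‖c‖₊ * C) (hC.const_smul_real c)).trans (le_of_eq ?_)
  rw [ENNReal.coe_mul]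
  rfl

/-- **Homogeneity of the Hölder seminorm** under real scalars: `[c • f]_r = |c| [f]_r`
(cf. Mathlib's `eHolderNorm_smul`, for metric sources). [folklore] -/
theorem eHolderNorm_const_smul_eq [PseudoEMetricSpace X] [NormedSpace ℝ Y] (r : ℝ≥0) (c : ℝ)
    (f : X → Y) : eHolderNorm r (c • f) = ‖c‖ₑ * eHolderNorm r f := by
  refine le_antisymm (eHolderNorm_const_smul_le r c f) ?_
  rcases eq_or_ne c 0 with rfl | hc
  · simp
  have h := eHolderNorm_const_smul_le r c⁻¹ (c • f)
  rw [smul_smul, inv_mul_cancel₀ hc, one_smul] at h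
  calc ‖c‖ₑ * eHolderNorm r f ≤ ‖c‖ₑ * (‖c⁻¹‖ₑ * eHolderNorm r (c • f)) := by gcongr
    _ = eHolderNorm r (c • f) := by
        rw [← mul_assoc, ← enorm_mul, mul_inv_cancel₀ hc, enorm_one, one_mul]

/-- The Hölder seminorm is invariant under negation. [folklore] -/
theorem eHolderNorm_neg_eq [PseudoEMetricSpace X] [NormedSpace ℝ Y] (r : ℝ≥0) (f : X → Y) :
    eHolderNorm r (-f) = eHolderNorm r f := by
  rw [← neg_one_smul ℝ f, eHolderNorm_const_smul_eq, enorm_neg, enorm_one, one_mul]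

end Elementary

/-! ## The `C^{k,r}` norms on a real normed space -/

section Euclidean

variable {E' Y : Type*} [NormedAddCommGroup E'] [NormedSpace ℝ E'] [NormedAddCommGroup Y]
  [NormedSpace ℝ Y]
variable {k : ℕ} {r : ℝ≥0} {f g : E' → Y}

/-- `‖Dʲf(x)‖ ≤ ‖f‖_{C^{k,r}}` for `j ≤ k` (Gilbarg–Trudinger (4.4)). [folklore] -/
theorem enorm_iteratedFDeriv_le_eContDiffHolderNorm {j : ℕ} (hj : j ≤ k) (r : ℝ≥0) (f : E' → Y)
    (x : E') : ‖iteratedFDeriv ℝ j f x‖ₑ ≤ eContDiffHolderNorm k r f := by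
  unfold eContDiffHolderNorm
  refine le_trans ?_ le_self_add
  refine (enorm_le_eSupNorm _ x).trans ?_
  exact Finset.single_le_sum (f := fun i => eSupNorm (iteratedFDeriv ℝ i f)) (fun _ _ => bot_le)
    (Finset.mem_range.2 (Nat.lt_succ_of_le hj))

/-- `‖f(x)‖ ≤ ‖f‖_{C^{k,r}}`. [folklore] -/
theorem enorm_le_eContDiffHolderNorm (k : ℕ) (r : ℝ≥0) (f : E' → Y) (x : E') :
    ‖f x‖ₑ ≤ eContDiffHolderNorm k r f := by
  have h := enorm_iteratedFDeriv_le_eContDiffHolderNorm (Nat.zero_le k) r f x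
  rwa [← ofReal_norm, norm_iteratedFDeriv_zero, ofReal_norm] at h

/-- `[Dᵏf]_r ≤ ‖f‖_{C^{k,r}}`. [folklore] -/
theorem eHolderNorm_iteratedFDeriv_le_eContDiffHolderNorm (k : ℕ) (r : ℝ≥0) (f : E' → Y) :
    eHolderNorm r (iteratedFDeriv ℝ k f) ≤ eContDiffHolderNorm k r f :=
  le_add_self

/-- The `C^{k,r}` norm of the zero map vanishes. [folklore] -/
theorem eContDiffHolderNorm_zero_fun (k : ℕ) (r : ℝ≥0) :
    eContDiffHolderNorm k r (0 : E' → Y) = 0 := by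
  simp [eContDiffHolderNorm, iteratedFDeriv_zero, eSupNorm_zero, eHolderNorm_zero]

/-- **Triangle inequality** for the `C^{k,r}` norm of `C^k` maps (the derivatives are additive on
`C^k`). [folklore] -/
theorem eContDiffHolderNorm_add_le (hf : ContDiff ℝ k f) (hg : ContDiff ℝ k g) :
    eContDiffHolderNorm k r (f + g) ≤ eContDiffHolderNorm k r f + eContDiffHolderNorm k r g := by
  have hD : ∀ j ≤ k, iteratedFDeriv ℝ j (f + g) = iteratedFDeriv ℝ j f + iteratedFDeriv ℝ j g :=
    fun j hj => iteratedFDeriv_add (hf.of_le (by exact_mod_cast hj)) (hg.of_le (by exact_mod_cast hj))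
  unfold eContDiffHolderNorm
  calc (∑ j ∈ Finset.range (k + 1), eSupNorm (iteratedFDeriv ℝ j (f + g))) +
        eHolderNorm r (iteratedFDeriv ℝ k (f + g))
      ≤ (∑ j ∈ Finset.range (k + 1), (eSupNorm (iteratedFDeriv ℝ j f) + eSupNorm (iteratedFDeriv ℝ j g))) +
        (eHolderNorm r (iteratedFDeriv ℝ k f) + eHolderNorm r (iteratedFDeriv ℝ k g)) := by
        refine add_le_add (Finset.sum_le_sum fun j hj => ?_) ?_
        · rw [hD j (by simpa [Finset.mem_range, Nat.lt_succ_iff] using hj)]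
          exact eSupNorm_add_le _ _
        · rw [hD k le_rfl]
          exact eHolderNorm_add_le
    _ = _ := by
        rw [Finset.sum_add_distrib]
        ring

/-- The `C^{k,r}` norm is invariant under negation. [folklore] -/
theorem eContDiffHolderNorm_neg (k : ℕ) (r : ℝ≥0) (f : E' → Y) :
    eContDiffHolderNorm k r (-f) = eContDiffHolderNorm k r f := by
  simp only [eContDiffHolderNorm, iteratedFDeriv_neg, eSupNorm_neg, eHolderNorm_neg_eq]

/-- Triangle inequality for differences of `C^k` maps. [folklore] -/
theorem eContDiffHolderNorm_sub_le (hf : ContDiff ℝ k f) (hg : ContDiff ℝ k g) :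
    eContDiffHolderNorm k r (f - g) ≤ eContDiffHolderNorm k r f + eContDiffHolderNorm k r g := by
  have hg' : ContDiff ℝ k (-g) := hg.neg
  rw [sub_eq_add_neg]
  exact (eContDiffHolderNorm_add_le hf hg').trans (by rw [eContDiffHolderNorm_neg])

/-- **Homogeneity**: `‖c • f‖_{C^{k,r}} = |c| ‖f‖_{C^{k,r}}` for `C^k` maps and real `c`. [folklore] -/
theorem eContDiffHolderNorm_const_smul (hf : ContDiff ℝ k f) (c : ℝ) :
    eContDiffHolderNorm k r (c • f) = ‖c‖ₑ * eContDiffHolderNorm k r f := by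
  have hD : ∀ j ≤ k, iteratedFDeriv ℝ j (c • f) = c • iteratedFDeriv ℝ j f := fun j hj =>
    funext fun x => iteratedFDeriv_const_smul_apply ((hf.of_le (by exact_mod_cast hj)).contDiffAt)
  unfold eContDiffHolderNorm
  rw [mul_add, Finset.mul_sum]
  congr 1
  · refine Finset.sum_congr rfl fun j hj => ?_
    rw [hD j (by simpa [Finset.mem_range, Nat.lt_succ_iff] using hj), eSupNorm_const_smul_eq]
  · -- explicit arguments: the value type is a space of multilinear maps, whose `SMul` instance is
    -- not syntactically the `Module`-derived one (unification with metavariables would time out)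
    rw [hD k le_rfl, eHolderNorm_const_smul_eq r c (iteratedFDeriv ℝ k f)]

/-- Triangle inequality for finite sums of `C^k` maps. [folklore] -/
theorem eContDiffHolderNorm_sum_le {ι : Type*} (s : Finset ι) {F : ι → E' → Y}
    (hF : ∀ i ∈ s, ContDiff ℝ k (F i)) :
    eContDiffHolderNorm k r (∑ i ∈ s, F i) ≤ ∑ i ∈ s, eContDiffHolderNorm k r (F i) := by
  classical
  induction s using Finset.induction_on with
  | empty => simp [eContDiffHolderNorm_zero_fun]
  | insert a s ha ih =>
    rw [Finset.sum_insert ha, Finset.sum_insert ha]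
    have hs : ∀ i ∈ s, ContDiff ℝ k (F i) := fun i hi => hF i (Finset.mem_insert_of_mem hi)
    have hsum : ContDiff ℝ k (∑ i ∈ s, F i) := by
      rw [show (∑ i ∈ s, F i) = fun x => ∑ i ∈ s, F i x from funext fun x => Finset.sum_apply x s F]
      exact ContDiff.sum hs
    exact (eContDiffHolderNorm_add_le (hF a (Finset.mem_insert_self a s)) hsum).trans
      (add_le_add le_rfl (ih hs))

/-- **Exponent `0` versus exponent `r`**: `‖f‖_{C^{k,0}} ≤ 3 ‖f‖_{C^{k,r}}` (the `0`-seminorm of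
`Dᵏf` is its oscillation, at most `2‖Dᵏf‖_∞`). [folklore] -/
theorem eContDiffHolderNorm_exponent_zero_le (k : ℕ) (r : ℝ≥0) (f : E' → Y) :
    eContDiffHolderNorm k 0 f ≤ 3 * eContDiffHolderNorm k r f := by
  unfold eContDiffHolderNorm
  set S := ∑ j ∈ Finset.range (k + 1), eSupNorm (iteratedFDeriv ℝ j f) with hS
  have h1 := eHolderNorm_zero_le_two_mul_eSupNorm (iteratedFDeriv ℝ k f)
  have h2 : eSupNorm (iteratedFDeriv ℝ k f) ≤ S :=
    Finset.single_le_sum (f := fun i => eSupNorm (iteratedFDeriv ℝ i f)) (fun _ _ => bot_le)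
      (Finset.self_mem_range_succ k)
  calc S + eHolderNorm 0 (iteratedFDeriv ℝ k f) ≤ S + 2 * S := by
        gcongr
        exact h1.trans (by gcongr)
    _ = 3 * S := by ring
    _ ≤ 3 * (S + eHolderNorm r (iteratedFDeriv ℝ k f)) := by
        gcongr
        exact le_self_add

/-- **Interpolation at unit scale.** For a `C^{k+1}` map with `‖Dᵏ⁺¹f‖_∞ < ∞` and `‖Dᵏf‖_∞ < ∞`,
`Dᵏf` is `r`-Hölder, `r ≤ 1`, with constant `‖Dᵏ⁺¹f‖_∞ + 2‖Dᵏf‖_∞` (mean value inequality for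
increments `≤ 1`, oscillation for the others; Gilbarg–Trudinger (6.8)–(6.9)). [folklore] -/
theorem holderWith_iteratedFDeriv_of_eSupNorm_ne_top (hf : ContDiff ℝ (k + 1) f)
    (h1 : eSupNorm (iteratedFDeriv ℝ (k + 1) f) ≠ ⊤) (h0 : eSupNorm (iteratedFDeriv ℝ k f) ≠ ⊤)
    (hr : r ≤ 1) :
    HolderWith ((eSupNorm (iteratedFDeriv ℝ (k + 1) f)).toNNReal +
      (2 * eSupNorm (iteratedFDeriv ℝ k f)).toNNReal) r (iteratedFDeriv ℝ k f) := by
  set L := (eSupNorm (iteratedFDeriv ℝ (k + 1) f)).toNNReal with hL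
  set B := (2 * eSupNorm (iteratedFDeriv ℝ k f)).toNNReal with hB
  have h2 : 2 * eSupNorm (iteratedFDeriv ℝ k f) ≠ ⊤ := ENNReal.mul_ne_top (by norm_num) h0
  have hLip : LipschitzWith L (iteratedFDeriv ℝ k f) := by
    refine lipschitzWith_of_nnnorm_fderiv_le
      (hf.differentiable_iteratedFDeriv (by exact_mod_cast Nat.lt_succ_self k)) fun x => ?_
    rw [← ENNReal.coe_le_coe, hL, ENNReal.coe_toNNReal h1, ← enorm_eq_nnnorm, ← ofReal_norm,
      norm_fderiv_iteratedFDeriv, ofReal_norm]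
    exact enorm_le_eSupNorm _ x
  have hosc : ∀ x y, edist (iteratedFDeriv ℝ k f x) (iteratedFDeriv ℝ k f y) ≤ B := by
    intro x y
    rw [hB, ENNReal.coe_toNNReal h2, edist_eq_enorm_sub]
    calc ‖iteratedFDeriv ℝ k f x - iteratedFDeriv ℝ k f y‖ₑ
        ≤ ‖iteratedFDeriv ℝ k f x‖ₑ + ‖iteratedFDeriv ℝ k f y‖ₑ := enorm_sub_le
      _ ≤ eSupNorm (iteratedFDeriv ℝ k f) + eSupNorm (iteratedFDeriv ℝ k f) :=
          add_le_add (enorm_le_eSupNorm _ x) (enorm_le_eSupNorm _ y)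
      _ = 2 * eSupNorm (iteratedFDeriv ℝ k f) := (two_mul _).symm
  have h := holderWith_of_lipschitzWith_of_edist_le hLip hosc hr (δ := 1) one_pos
  simpa using h

/-- **Order `k` versus order `k+1`**: `‖f‖_{C^{k,r}} ≤ 3 ‖f‖_{C^{k+1,r'}}` for `C^{k+1}` maps,
`r ≤ 1` and any `r'` (the top seminorm `[Dᵏf]_r ≤ ‖Dᵏ⁺¹f‖_∞ + 2‖Dᵏf‖_∞`; BDSV App. A,
"`[f]_s ≤ C(ε^{r-s}[f]_r + ε^{-s}‖f‖₀)`" (A.1) at `ε = 1`). [folklore] -/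
theorem eContDiffHolderNorm_le_three_mul_succ (hf : ContDiff ℝ (k + 1) f) (hr : r ≤ 1) (r' : ℝ≥0) :
    eContDiffHolderNorm k r f ≤ 3 * eContDiffHolderNorm (k + 1) r' f := by
  unfold eContDiffHolderNorm
  set S := ∑ j ∈ Finset.range (k + 1), eSupNorm (iteratedFDeriv ℝ j f) with hS
  set S' := ∑ j ∈ Finset.range (k + 1 + 1), eSupNorm (iteratedFDeriv ℝ j f) with hS'
  have hSS' : S' = S + eSupNorm (iteratedFDeriv ℝ (k + 1) f) := Finset.sum_range_succ _ _
  have hkS : eSupNorm (iteratedFDeriv ℝ k f) ≤ S :=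
    Finset.single_le_sum (f := fun i => eSupNorm (iteratedFDeriv ℝ i f)) (fun _ _ => bot_le)
      (Finset.self_mem_range_succ k)
  -- the top Hölder seminorm
  have hH : eHolderNorm r (iteratedFDeriv ℝ k f) ≤
      eSupNorm (iteratedFDeriv ℝ (k + 1) f) + 2 * eSupNorm (iteratedFDeriv ℝ k f) := by
    by_cases h1 : eSupNorm (iteratedFDeriv ℝ (k + 1) f) = ⊤
    · rw [h1, top_add]; exact le_top
    by_cases h0 : eSupNorm (iteratedFDeriv ℝ k f) = ⊤
    · rw [h0, ENNReal.mul_top (by norm_num), add_top]; exact le_top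
    have h2 : 2 * eSupNorm (iteratedFDeriv ℝ k f) ≠ ⊤ := ENNReal.mul_ne_top (by norm_num) h0
    refine (holderWith_iteratedFDeriv_of_eSupNorm_ne_top hf h1 h0 hr).eHolderNorm_le.trans (le_of_eq ?_)
    rw [ENNReal.coe_add, ENNReal.coe_toNNReal h1, ENNReal.coe_toNNReal h2]
  calc S + eHolderNorm r (iteratedFDeriv ℝ k f)
      ≤ S + (eSupNorm (iteratedFDeriv ℝ (k + 1) f) + 2 * eSupNorm (iteratedFDeriv ℝ k f)) :=
        add_le_add le_rfl hH
    _ ≤ S' + 2 * S' := by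
        rw [hSS', ← add_assoc]
        gcongr
        exact hkS.trans le_self_add
    _ = 3 * S' := by ring
    _ ≤ 3 * (S' + eHolderNorm r' (iteratedFDeriv ℝ (k + 1) f)) := by
        gcongr
        exact le_self_add

/-- The `C^{k,r}` norm is invariant under translation of the argument. [folklore] -/
theorem eContDiffHolderNorm_comp_add_right (k : ℕ) (r : ℝ≥0) (f : E' → Y) (a : E') :
    eContDiffHolderNorm k r (fun z => f (z + a)) = eContDiffHolderNorm k r f := by
  have hD : ∀ j : ℕ, iteratedFDeriv ℝ j (fun z => f (z + a)) = fun x => iteratedFDeriv ℝ j f (x + a) :=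
    fun j => iteratedFDeriv_comp_add_right' j a
  have hsup : ∀ j : ℕ, eSupNorm (iteratedFDeriv ℝ j (fun z => f (z + a))) = eSupNorm (iteratedFDeriv ℝ j f) := by
    intro j
    rw [hD j]
    refine le_antisymm (iSup_le fun x => enorm_le_eSupNorm _ (x + a)) (iSup_le fun x => ?_)
    have h := enorm_le_eSupNorm (fun x => iteratedFDeriv ℝ j f (x + a)) (x - a)
    rwa [sub_add_cancel] at h
  have hhol : eHolderNorm r (iteratedFDeriv ℝ k (fun z => f (z + a))) = eHolderNorm r (iteratedFDeriv ℝ k f) := by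
    rw [hD k]
    refine le_antisymm ?_ ?_
    · refine le_iInf₂ fun C hC => HolderWith.eHolderNorm_le fun x y => ?_
      have h := hC (x + a) (y + a)
      rwa [edist_add_right] at h
    · refine le_iInf₂ fun C hC => HolderWith.eHolderNorm_le fun x y => ?_
      have h := hC (x - a) (y - a)
      simp only [sub_add_cancel, edist_sub_right] at h
      exact h
  simp only [eContDiffHolderNorm, hsup, hhol]

end Euclidean

/-! ## The `C^{k,r}` norms on the flat torus -/

namespace Torus

variable {d : Type*} [Fintype d] {Y : Type*} [NormedAddCommGroup Y] [NormedSpace ℝ Y]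
variable {k : ℕ} {r : ℝ≥0} {f g : UnitAddTorus d → Y}

omit [Fintype d] [NormedSpace ℝ Y] in
/-- The lift is additive. [folklore] -/
theorem lift_add (f g : UnitAddTorus d → Y) : lift (f + g) = lift f + lift g := rfl

omit [Fintype d] [NormedSpace ℝ Y] in
/-- The lift commutes with negation. [folklore] -/
theorem lift_neg (f : UnitAddTorus d → Y) : lift (-f) = -lift f := rfl

omit [Fintype d] [NormedSpace ℝ Y] in
/-- The lift commutes with subtraction. [folklore] -/
theorem lift_sub (f g : UnitAddTorus d → Y) : lift (f - g) = lift f - lift g := rfl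

omit [Fintype d] in
/-- The lift commutes with real scalars. [folklore] -/
theorem lift_const_smul (c : ℝ) (f : UnitAddTorus d → Y) : lift (c • f) = c • lift f := rfl

omit [Fintype d] [NormedSpace ℝ Y] in
/-- The lift of the zero map is zero. [folklore] -/
theorem lift_zero : lift (0 : UnitAddTorus d → Y) = 0 := rfl

omit [Fintype d] [NormedSpace ℝ Y] in
/-- The lift commutes with finite sums. [folklore] -/
theorem lift_sum {ι : Type*} (s : Finset ι) (F : ι → UnitAddTorus d → Y) :
    lift (∑ i ∈ s, F i) = ∑ i ∈ s, lift (F i) := by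
  funext y
  simp [lift_apply, Finset.sum_apply]

/-- `‖g(x)‖ ≤ ‖g‖_{C^{k,r}(T^d)}`. [folklore] -/
theorem enorm_le_eContDiffHolderNorm (k : ℕ) (r : ℝ≥0) (g : UnitAddTorus d → Y) (x : UnitAddTorus d) :
    ‖g x‖ₑ ≤ Torus.eContDiffHolderNorm k r g := by
  obtain ⟨y, rfl⟩ := proj_surjective x
  exact FunctionSpaces.enorm_le_eContDiffHolderNorm k r (lift g) y

/-- `‖Dʲ(lift g)(y)‖ ≤ ‖g‖_{C^{k,r}(T^d)}` for `j ≤ k`. [folklore] -/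
theorem enorm_iteratedFDeriv_lift_le_eContDiffHolderNorm {j : ℕ} (hj : j ≤ k) (r : ℝ≥0)
    (g : UnitAddTorus d → Y) (y : EuclideanSpace ℝ d) :
    ‖iteratedFDeriv ℝ j (lift g) y‖ₑ ≤ Torus.eContDiffHolderNorm k r g :=
  FunctionSpaces.enorm_iteratedFDeriv_le_eContDiffHolderNorm hj r (lift g) y

/-- The `C^{k,r}(T^d)` norm of the zero map vanishes. [folklore] -/
theorem eContDiffHolderNorm_zero_fun (k : ℕ) (r : ℝ≥0) :
    Torus.eContDiffHolderNorm k r (0 : UnitAddTorus d → Y) = 0 :=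
  FunctionSpaces.eContDiffHolderNorm_zero_fun k r

/-- Triangle inequality for the `C^{k,r}(T^d)` norm of `C^k` maps. [folklore] -/
theorem eContDiffHolderNorm_add_le (hf : IsContDiff k f) (hg : IsContDiff k g) :
    Torus.eContDiffHolderNorm k r (f + g) ≤ Torus.eContDiffHolderNorm k r f + Torus.eContDiffHolderNorm k r g :=
  FunctionSpaces.eContDiffHolderNorm_add_le hf hg

/-- The `C^{k,r}(T^d)` norm is invariant under negation. [folklore] -/
theorem eContDiffHolderNorm_neg (k : ℕ) (r : ℝ≥0) (f : UnitAddTorus d → Y) :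
    Torus.eContDiffHolderNorm k r (-f) = Torus.eContDiffHolderNorm k r f :=
  FunctionSpaces.eContDiffHolderNorm_neg k r (lift f)

/-- Triangle inequality for differences of `C^k` maps on the torus. [folklore] -/
theorem eContDiffHolderNorm_sub_le (hf : IsContDiff k f) (hg : IsContDiff k g) :
    Torus.eContDiffHolderNorm k r (f - g) ≤ Torus.eContDiffHolderNorm k r f + Torus.eContDiffHolderNorm k r g :=
  FunctionSpaces.eContDiffHolderNorm_sub_le hf hg

/-- Homogeneity of the `C^{k,r}(T^d)` norm of `C^k` maps under real scalars. [folklore] -/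
theorem eContDiffHolderNorm_const_smul (hf : IsContDiff k f) (c : ℝ) :
    Torus.eContDiffHolderNorm k r (c • f) = ‖c‖ₑ * Torus.eContDiffHolderNorm k r f :=
  FunctionSpaces.eContDiffHolderNorm_const_smul hf c

/-- Triangle inequality for finite sums of `C^k` maps on the torus. [folklore] -/
theorem eContDiffHolderNorm_sum_le {ι : Type*} (s : Finset ι) {F : ι → UnitAddTorus d → Y}
    (hF : ∀ i ∈ s, IsContDiff k (F i)) :
    Torus.eContDiffHolderNorm k r (∑ i ∈ s, F i) ≤ ∑ i ∈ s, Torus.eContDiffHolderNorm k r (F i) := by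
  unfold Torus.eContDiffHolderNorm
  rw [lift_sum]
  exact FunctionSpaces.eContDiffHolderNorm_sum_le s hF

/-- `‖g‖_{C^{k,0}(T^d)} ≤ 3 ‖g‖_{C^{k,r}(T^d)}`. [folklore] -/
theorem eContDiffHolderNorm_exponent_zero_le (k : ℕ) (r : ℝ≥0) (g : UnitAddTorus d → Y) :
    Torus.eContDiffHolderNorm k 0 g ≤ 3 * Torus.eContDiffHolderNorm k r g :=
  FunctionSpaces.eContDiffHolderNorm_exponent_zero_le k r (lift g)

/-- `‖g‖_{C^{k,r}(T^d)} ≤ 3 ‖g‖_{C^{k+1,r'}(T^d)}` for `C^{k+1}` maps and `r ≤ 1`. [folklore] -/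
theorem eContDiffHolderNorm_le_three_mul_succ (hf : IsContDiff (k + 1 : ℕ) f) (hr : r ≤ 1) (r' : ℝ≥0) :
    Torus.eContDiffHolderNorm k r f ≤ 3 * Torus.eContDiffHolderNorm (k + 1) r' f :=
  FunctionSpaces.eContDiffHolderNorm_le_three_mul_succ hf hr r'

/-- The `C^{k,r}(T^d)` norm is invariant under translation of the argument. [folklore] -/
theorem eContDiffHolderNorm_comp_add_right (k : ℕ) (r : ℝ≥0) (g : UnitAddTorus d → Y)
    (a : UnitAddTorus d) :
    Torus.eContDiffHolderNorm k r (fun x => g (x + a)) = Torus.eContDiffHolderNorm k r g := by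
  obtain ⟨b, rfl⟩ := proj_surjective a
  have h : lift (fun x => g (x + proj b)) = fun z => lift g (z + b) := by
    funext z
    simp [lift_apply, proj_add]
  unfold Torus.eContDiffHolderNorm
  rw [h, FunctionSpaces.eContDiffHolderNorm_comp_add_right]

/-! ### Finiteness for smooth maps (from the discharged `Torus.IsSmooth.memContDiffHolder`) -/

/-- Smooth functions on the torus have finite `C^{k,r}` norm for `r ≤ 1`. [folklore] -/
theorem IsSmooth.eContDiffHolderNorm_lt_top (hf : IsSmooth f) (k : ℕ) (hr : r ≤ 1) :
    Torus.eContDiffHolderNorm k r f < ⊤ :=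
  (IsSmooth.memContDiffHolder_holds hf k hr).eContDiffHolderNorm_lt_top

/-- For smooth `f` on the torus and `r ≤ 1`, `Dᵏ(lift f)` is `r`-Hölder with constant the (finite)
`C^{k,r}` norm. [folklore] -/
theorem IsSmooth.holderWith_iteratedFDeriv (hf : IsSmooth f) (k : ℕ) (hr : r ≤ 1) :
    HolderWith (Torus.eContDiffHolderNorm k r f).toNNReal r (iteratedFDeriv ℝ k (lift f)) := by
  have hmem := (IsSmooth.memContDiffHolder_holds hf k hr).memHolder_iteratedFDeriv
  refine hmem.holderWith.mono ?_
  rw [← ENNReal.coe_le_coe, hmem.coe_nnHolderNorm_eq_eHolderNorm,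
    ENNReal.coe_toNNReal (hf.eContDiffHolderNorm_lt_top k hr).ne]
  exact FunctionSpaces.eHolderNorm_iteratedFDeriv_le_eContDiffHolderNorm k r (lift f)

end Torus

end Literature.Analysis.FunctionSpaces
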